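/-
Copyright (c) 2026 the pub-hodgecm-mathlib formalisation cell (harness21).  Prover seat hodgecm-mathlib-LH4-p08 (g7), req620 Track A «(D-RAM) FOUR-FRAME» squad, helper lane
on h413 = stmt-HodgeConjecture-24833 (count-neutral).  STAGE-1b typed inventory (heir LEAD F0P3a-plan (g20) T19-24): ROW (3) G-SIDE OF THE LABELLED PIECE `f_{T+}` — EXACT LAW.  2026-09-04.
-/
import Summits.HodgeConjecture.HodgeConjecture.Theorems.F0P3cDyRamPieceRegLeviRow               -- ★ p859150 (this seat): `measureReal_setOf_mem_cmLocalIntegralLevel_ne_zero`; brings ★ p858969, ★ `DOfPlaceOfDatum`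
import Summits.HodgeConjecture.HodgeConjecture.Theorems.F0P3cDyRamTransvPlusUnipotentVolume      -- ★ p859349 (LH4-p10 (g5), (N-vol-wild) FILE 4c): `measure_setOf_mem_and_nearTransvShell_and_labelPlus_eq` (ρ_{T+} = ½(1−q⁻¹)q^{−(d−1+ℓ₀)})
import Summits.HodgeConjecture.HodgeConjecture.Theorems.F0P3cDyRamProfilePiecesProps             -- ★ p854742: `isLocSmooth_pieceTransvPlus` (the labelled set is clopen)
import HarnessLib

/-!
# Crux `H413`, line LH4 «(D-RAM) FOUR-FRAME» — ROW (3) `G`-SIDE OF THE LABELLED NEAR-TRANSVECTION PIECE `f_{T+} = gselStar 1`, EXACT: near `1` on the Levi population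
# `Σᶠ_c Δ‴_v[μ](γ_H, out c)·Φ(c, f_{T+}) = ½(1 − q_v⁻¹)·q_v^{−(d−1+ℓ₀)} · (νG₃(K)∕νH(K_H)) · Φ^st(γ_H, hFamily 0)`  (`d ≥ 2`, `ℓ₀ = d % 2`)

Cell `hodgecm-mathlib` (D-0151), FLOOR 0, crux item H413 = `stmt-HodgeConjecture-24833`, route of record `HCCMUnconditional`; squad F0∕P3c∕LH4 (req618∕req620); helper lane
`--supports stmt-HodgeConjecture-24833 --as helper` (count-neutral).  THEOREMS ONLY (no `def`, no instance, no notation, no `sorry`; default heartbeats).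

WHAT.  ROW (3) of the tier-0 row `F0P3cDyRamFourFrame.stub_rows_transvPlus : PieceRowsWild gselStar 1` (@92 of ED. 4): ★ p858969 gave its `G`-side in closed form modulo
`∫_N f_{T+} dμ_N`; LH4-p10 (g5)'s ★ p859349 evaluates the LABELLED SHELL FIBRE of `N ∩ K` at a wild ramified datum `(ϖ, d, t_E)`, `d ≥ 2`:
`μ_N{n ∈ K : shell_{(ℓ₀, m*)}(n_w − 1) ∧ LabelPlus(n_w − 1)} = ½(1 − q_v⁻¹)·q_v^{−((ℓ₀+3d−1)∕2 − ⌊d∕2⌋)}·μ_N{n ∈ K}` — the support condition of ★ DEFS №3 `pieceTransvPlus` read on `N` at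
`dOfPlace = d`, `mstarFn = ℓ₀ + 2d − 1` (★ `dOfPlace_eq_of_isRamifiedQuadraticDatum`, ★ `mstarFn_eq_of_isRamifiedQuadraticDatum`).  §1 turns `∫_N f_{T+}` into that measure (the set is
the preimage of the clopen support of the locally constant `f_{T+}`, ★ `isLocSmooth_pieceTransvPlus`), and §2 cancels `μ_N{n ∈ K} ≠ 0` (★ p859150) in ★ p858969 (`j = 1`):
THE EXACT LAW `Σᶠ_c Δ‴(γ_H, out c)·Φ(c, f_{T+}) = ½(1 − q_v⁻¹)q_v^{−(d−1+ℓ₀)}·(νG₃(K)∕νH(K_H))·Φ^st(γ_H, hFamily 0)` — the Levi fibre-volume fraction `ρ_{T+}` predicted by the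
(L-T+) re-fit of record (heir LEAD T19-32 (a): «the q^k-coefficient ½(1 − q⁻¹)q^{−(d−1+ℓ₀)} = ρ_{T+} of the Levi law EXACTLY»).  With `ψ := hFamily`, ROW (3) of `stub_rows_transvPlus` is the
scalar identity `a_0 ν_0 + a_1 ν_1 = ρ_{T+}·(νG₃(K)∕νH(K_H))·ν_0`.  (Lean's `pieceTransvMinus = shell − f_{T+}`, ★ p858649: its law is the (ℓ₀, m*) ∕ (ℓ₀+1, m*) levels laws ★ p859211
minus this one, by linearity.)

* `integral_gselStar_one_eq` — `∫_N f_{T+} dμ_N = μ_N.real{n ∈ K, shell, LabelPlus}` (★ p859349's set TOKEN FOR TOKEN, under the datum).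
* `exists_nhds_one_finsum_delta_pieceTransvPlus_eq_of_levi` — THE EXACT LAW above.
HONEST LABEL.  Count-neutral (`--supports`): composition BY NAME over ★ only; pays no registered stub and touches no `Lines/` module; the three tier-0 rows stay OPEN;
`HC_CM` is proved only modulo the 7 printed citations (2 remaining named inputs: hLiu418 = `stmt-HodgeConjecture-24832`, h413 = `stmt-HodgeConjecture-24833`) until rung 0 closes.

## References
* [Rogawski1990] J. D. Rogawski, *Automorphic Representations of Unitary Groups in Three Variables*, Ann. of Math. Stud. 123 (1990): §4.9 Prop. 4.9.1 (b) p. 55, Lemma 4.9.2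
  p. 56; §4.3 (4.3.1) p. 43; §3.5 Prop. 3.5.2 pp. 25–26.
* [Kottwitz1986BaseChangeUnits] R. E. Kottwitz, *Base change for unit elements of Hecke algebras*, Compositio Math. 60 (1986), §1 pp. 240–241.
* [Serre1979] J.-P. Serre, *Local Fields*, GTM 67 (1979), Ch. IV §1 Prop. 4; Ch. V §3 (norm-residue index of a ramified quadratic extension).
-/

set_option autoImplicit false

noncomputable section

namespace Summit.HodgeConjecture.HodgeConjecture.Cruxes.H413.F0P3cDyRamTransvPlusLeviRow

open MeasureTheory Measure NumberField IsDedekindDomain Topology Filter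
open Literature.NumberTheory.Automorphic Literature.NumberTheory.Automorphic.UnitaryGroup Literature.NumberTheory.Automorphic.IntegralReduction
open Literature.NumberTheory.Automorphic.UnitaryLatticeTree Literature.NumberTheory.Automorphic.HermitianLattice
open Literature.NumberTheory.Automorphic.UnitaryThreeFourFrame
open Literature.NumberTheory.Rogawski1990 Literature.NumberTheory.GaloisRepresentations
open scoped Matrix MatrixGroups Classical ValuativeRel WithZero NNReal ENNReal
open Summit.HodgeConjecture.HodgeConjecture.Cruxes.H413.F0P3cDyRamFourFramePieces
open Summit.HodgeConjecture.HodgeConjecture.Cruxes.H413.F0P3cDyRamFourFrameHFamilyDefs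
open Summit.HodgeConjecture.HodgeConjecture.Cruxes.H413.F0P3cDyRamProfilePiecesProps
open Summit.HodgeConjecture.HodgeConjecture.Cruxes.H413.F0P3cDyRamPieceLeviRow
open Summit.HodgeConjecture.HodgeConjecture.Cruxes.H413.F0P3cDyRamPieceRegLeviRow
open Summit.HodgeConjecture.HodgeConjecture.Cruxes.H413.F0P3cDyRamDOfPlaceOfDatum
open Summit.HodgeConjecture.HodgeConjecture.Cruxes.H413.F0P3cDyRamTransvPlusUnipotentVolume

/-! ## §1  The labelled piece's unipotent-fibre volume -/

/-- **`∫_N f_{T+} dμ_N = μ_N.real{n ∈ K : shell(n_w − 1) ∧ LabelPlus(n_w − 1)}`** at the datum `(ϖ, d, t_E)` (`f_{T+} = gselStar 1 = pieceTransvPlus`, `rfl`; `dOfPlace = d`,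
`mstarFn = d%2 + 2d − 1`; the `N`-set is the preimage of the clopen support of the locally constant `f_{T+}`, hence Borel, and lies in the compact `{n ∈ K}`).
[cite: Rogawski1990, §4.9 Prop. 4.9.1 (b) p. 55] [cite: Kottwitz1986BaseChangeUnits, §1 pp. 240–241] -/
theorem integral_gselStar_one_eq
    (L : Type) [Field L] [NumberField L] [IsCMField L]
    {v : HeightOneSpectrum (𝓞 ↥(maximalRealSubfield L))} (w : UnitaryGroup.PlacesOver L v)
    (hw : IsCMField.complexConj L • w.1 = w.1) (he : v.asIdeal.ramificationIdx' w.1.asIdeal ≠ 1)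
    (ϖ : w.1.adicCompletion L) (hϖ : Valued.v ϖ = WithZero.exp (-1 : ℤ))
    {d tE : ℕ} (hD : IsRamifiedQuadraticDatum (galAdicCompletionMap (L := L) (IsCMField.complexConj L) hw) ϖ d tE)
    [MeasurableSpace ↥(unitaryGroupOfForm (conjLocal L (IsCMField.complexConj L) v) (cmLocalForm L 3 v))] [BorelSpace ↥(unitaryGroupOfForm (conjLocal L (IsCMField.complexConj L) v) (cmLocalForm L 3 v))]
    (μN : Measure ↥(unipotentU (conjLocal L (IsCMField.complexConj L) v) (cmLocalForm L 3 v))) :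
    ∫ n : ↥(unipotentU (conjLocal L (IsCMField.complexConj L) v) (cmLocalForm L 3 v)), (gselStar 1) L v w hw ϖ ((n : ↥(unitaryGroupOfForm (conjLocal L (IsCMField.complexConj L) v) (cmLocalForm L 3 v))) : ((cmDatum L 3 (Matrix.of fun i j : Fin 3 => if i.val + j.val + 1 = 3 then (1 : L) else 0)).Local v)) ∂μN =
      ((μN.real {n : ↥(unipotentU (conjLocal L (IsCMField.complexConj L) v) (cmLocalForm L 3 v)) | (n : ↥(unitaryGroupOfForm (conjLocal L (IsCMField.complexConj L) v) (cmLocalForm L 3 v))) ∈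
            cmLocalIntegralLevel L 3 (Matrix.of fun i j : Fin 3 => if i.val + j.val + 1 = 3 then (1 : L) else 0) v ∧
          NearTransvShell ϖ (d % 2) (d % 2 + 2 * d - 1)
            (((n : ↥(unitaryGroupOfForm (conjLocal L (IsCMField.complexConj L) v) (cmLocalForm L 3 v))) : GL (Fin 3) (LocalRing L v)).val.map
                (Pi.evalRingHom (fun w' : PlacesOver L v => w'.1.adicCompletion L) w) - 1) ∧
          LabelPlus (galAdicCompletionMap (L := L) (IsCMField.complexConj L) hw) ϖ d (d % 2 + 2 * d - 1)
            (((n : ↥(unitaryGroupOfForm (conjLocal L (IsCMField.complexConj L) v) (cmLocalForm L 3 v))) : GL (Fin 3) (LocalRing L v)).val.map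
                (Pi.evalRingHom (fun w' : PlacesOver L v => w'.1.adicCompletion L) w) - 1)} : ℝ) : ℂ) := by
  have hdp : dOfPlace L v w = d := dOfPlace_eq_of_isRamifiedQuadraticDatum L w hw he hD
  have hmp : mstarFn L v w = d % 2 + 2 * d - 1 := mstarFn_eq_of_isRamifiedQuadraticDatum L w hw he hD
  -- the piece and its clopen support `A`
  have hg1 : (gselStar 1) L v w hw ϖ = Set.indicator {u : ((cmDatum L 3 (Matrix.of fun i j : Fin 3 => if i.val + j.val + 1 = 3 then (1 : L) else 0)).Local v) | u ∈ cmLocalIntegralLevel L 3 (Matrix.of fun i j : Fin 3 => if i.val + j.val + 1 = 3 then (1 : L) else 0) v ∧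
      NearTransvShell ϖ (dOfPlace L v w % 2) (mstarFn L v w) (wMatrix L w hw u - 1) ∧
      LabelPlus (galAdicCompletionMap (L := L) (IsCMField.complexConj L) hw) ϖ (dOfPlace L v w) (mstarFn L v w) (wMatrix L w hw u - 1)} (fun _ => (1 : ℂ)) := rfl
  have hA : IsOpen {u : ((cmDatum L 3 (Matrix.of fun i j : Fin 3 => if i.val + j.val + 1 = 3 then (1 : L) else 0)).Local v) | u ∈ cmLocalIntegralLevel L 3 (Matrix.of fun i j : Fin 3 => if i.val + j.val + 1 = 3 then (1 : L) else 0) v ∧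
      NearTransvShell ϖ (dOfPlace L v w % 2) (mstarFn L v w) (wMatrix L w hw u - 1) ∧
      LabelPlus (galAdicCompletionMap (L := L) (IsCMField.complexConj L) hw) ϖ (dOfPlace L v w) (mstarFn L v w) (wMatrix L w hw u - 1)} := by
    have hlc := (isLocSmooth_pieceTransvPlus L w hw hϖ).1.1
    have h := hlc.isOpen_fiber (1 : ℂ)
    have hset : {x : ((cmDatum L 3 (Matrix.of fun i j : Fin 3 => if i.val + j.val + 1 = 3 then (1 : L) else 0)).Local v) | pieceTransvPlus L v w hw ϖ x = 1} = {u : ((cmDatum L 3 (Matrix.of fun i j : Fin 3 => if i.val + j.val + 1 = 3 then (1 : L) else 0)).Local v) | u ∈ cmLocalIntegralLevel L 3 (Matrix.of fun i j : Fin 3 => if i.val + j.val + 1 = 3 then (1 : L) else 0) v ∧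
      NearTransvShell ϖ (dOfPlace L v w % 2) (mstarFn L v w) (wMatrix L w hw u - 1) ∧
      LabelPlus (galAdicCompletionMap (L := L) (IsCMField.complexConj L) hw) ϖ (dOfPlace L v w) (mstarFn L v w) (wMatrix L w hw u - 1)} := by
      ext u
      simp only [Set.mem_setOf_eq]
      show Set.indicator {u : ((cmDatum L 3 (Matrix.of fun i j : Fin 3 => if i.val + j.val + 1 = 3 then (1 : L) else 0)).Local v) | u ∈ cmLocalIntegralLevel L 3 (Matrix.of fun i j : Fin 3 => if i.val + j.val + 1 = 3 then (1 : L) else 0) v ∧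
      NearTransvShell ϖ (dOfPlace L v w % 2) (mstarFn L v w) (wMatrix L w hw u - 1) ∧
      LabelPlus (galAdicCompletionMap (L := L) (IsCMField.complexConj L) hw) ϖ (dOfPlace L v w) (mstarFn L v w) (wMatrix L w hw u - 1)} (fun _ => (1 : ℂ)) u = 1 ↔ _
      by_cases hu : u ∈ {u : ((cmDatum L 3 (Matrix.of fun i j : Fin 3 => if i.val + j.val + 1 = 3 then (1 : L) else 0)).Local v) | u ∈ cmLocalIntegralLevel L 3 (Matrix.of fun i j : Fin 3 => if i.val + j.val + 1 = 3 then (1 : L) else 0) v ∧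
      NearTransvShell ϖ (dOfPlace L v w % 2) (mstarFn L v w) (wMatrix L w hw u - 1) ∧
      LabelPlus (galAdicCompletionMap (L := L) (IsCMField.complexConj L) hw) ϖ (dOfPlace L v w) (mstarFn L v w) (wMatrix L w hw u - 1)}
      · exact ⟨fun _ => hu, fun _ => Set.indicator_of_mem hu _⟩
      · rw [Set.indicator_of_notMem hu]; exact ⟨fun h0 => absurd h0 zero_ne_one, fun h' => absurd h' hu⟩
    rw [hset] at h
    exact h
  -- the preimage on `N` is ★ p859349's set
  have hpre : (fun n : ↥(unipotentU (conjLocal L (IsCMField.complexConj L) v) (cmLocalForm L 3 v)) => ((n : ↥(unitaryGroupOfForm (conjLocal L (IsCMField.complexConj L) v) (cmLocalForm L 3 v))) : ((cmDatum L 3 (Matrix.of fun i j : Fin 3 => if i.val + j.val + 1 = 3 then (1 : L) else 0)).Local v))) ⁻¹' {u : ((cmDatum L 3 (Matrix.of fun i j : Fin 3 => if i.val + j.val + 1 = 3 then (1 : L) else 0)).Local v) | u ∈ cmLocalIntegralLevel L 3 (Matrix.of fun i j : Fin 3 => if i.val + j.val + 1 = 3 then (1 : L) else 0) v ∧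
      NearTransvShell ϖ (dOfPlace L v w % 2) (mstarFn L v w) (wMatrix L w hw u - 1) ∧
      LabelPlus (galAdicCompletionMap (L := L) (IsCMField.complexConj L) hw) ϖ (dOfPlace L v w) (mstarFn L v w) (wMatrix L w hw u - 1)} = {n : ↥(unipotentU (conjLocal L (IsCMField.complexConj L) v) (cmLocalForm L 3 v)) | (n : ↥(unitaryGroupOfForm (conjLocal L (IsCMField.complexConj L) v) (cmLocalForm L 3 v))) ∈
            cmLocalIntegralLevel L 3 (Matrix.of fun i j : Fin 3 => if i.val + j.val + 1 = 3 then (1 : L) else 0) v ∧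
          NearTransvShell ϖ (d % 2) (d % 2 + 2 * d - 1)
            (((n : ↥(unitaryGroupOfForm (conjLocal L (IsCMField.complexConj L) v) (cmLocalForm L 3 v))) : GL (Fin 3) (LocalRing L v)).val.map
                (Pi.evalRingHom (fun w' : PlacesOver L v => w'.1.adicCompletion L) w) - 1) ∧
          LabelPlus (galAdicCompletionMap (L := L) (IsCMField.complexConj L) hw) ϖ d (d % 2 + 2 * d - 1)
            (((n : ↥(unitaryGroupOfForm (conjLocal L (IsCMField.complexConj L) v) (cmLocalForm L 3 v))) : GL (Fin 3) (LocalRing L v)).val.map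
                (Pi.evalRingHom (fun w' : PlacesOver L v => w'.1.adicCompletion L) w) - 1)} := by
    ext n
    simp only [Set.mem_preimage, Set.mem_setOf_eq, wMatrix, coe_coe_localNonsplitEquiv_apply, hdp, hmp]
    rfl
  have hS : MeasurableSet {n : ↥(unipotentU (conjLocal L (IsCMField.complexConj L) v) (cmLocalForm L 3 v)) | (n : ↥(unitaryGroupOfForm (conjLocal L (IsCMField.complexConj L) v) (cmLocalForm L 3 v))) ∈
            cmLocalIntegralLevel L 3 (Matrix.of fun i j : Fin 3 => if i.val + j.val + 1 = 3 then (1 : L) else 0) v ∧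
          NearTransvShell ϖ (d % 2) (d % 2 + 2 * d - 1)
            (((n : ↥(unitaryGroupOfForm (conjLocal L (IsCMField.complexConj L) v) (cmLocalForm L 3 v))) : GL (Fin 3) (LocalRing L v)).val.map
                (Pi.evalRingHom (fun w' : PlacesOver L v => w'.1.adicCompletion L) w) - 1) ∧
          LabelPlus (galAdicCompletionMap (L := L) (IsCMField.complexConj L) hw) ϖ d (d % 2 + 2 * d - 1)
            (((n : ↥(unitaryGroupOfForm (conjLocal L (IsCMField.complexConj L) v) (cmLocalForm L 3 v))) : GL (Fin 3) (LocalRing L v)).val.map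
                (Pi.evalRingHom (fun w' : PlacesOver L v => w'.1.adicCompletion L) w) - 1)} := by
    rw [← hpre]
    exact (hA.preimage (show Continuous (fun n : ↥(unipotentU (conjLocal L (IsCMField.complexConj L) v) (cmLocalForm L 3 v)) => ((n : ↥(unitaryGroupOfForm (conjLocal L (IsCMField.complexConj L) v) (cmLocalForm L 3 v))) : ((cmDatum L 3 (Matrix.of fun i j : Fin 3 => if i.val + j.val + 1 = 3 then (1 : L) else 0)).Local v))) from continuous_subtype_val)).measurableSet
  have e : (fun n : ↥(unipotentU (conjLocal L (IsCMField.complexConj L) v) (cmLocalForm L 3 v)) => (gselStar 1) L v w hw ϖ ((n : ↥(unitaryGroupOfForm (conjLocal L (IsCMField.complexConj L) v) (cmLocalForm L 3 v))) : ((cmDatum L 3 (Matrix.of fun i j : Fin 3 => if i.val + j.val + 1 = 3 then (1 : L) else 0)).Local v))) = Set.indicator {n : ↥(unipotentU (conjLocal L (IsCMField.complexConj L) v) (cmLocalForm L 3 v)) | (n : ↥(unitaryGroupOfForm (conjLocal L (IsCMField.complexConj L) v) (cmLocalForm L 3 v))) ∈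
            cmLocalIntegralLevel L 3 (Matrix.of fun i j : Fin 3 => if i.val + j.val + 1 = 3 then (1 : L) else 0) v ∧
          NearTransvShell ϖ (d % 2) (d % 2 + 2 * d - 1)
            (((n : ↥(unitaryGroupOfForm (conjLocal L (IsCMField.complexConj L) v) (cmLocalForm L 3 v))) : GL (Fin 3) (LocalRing L v)).val.map
                (Pi.evalRingHom (fun w' : PlacesOver L v => w'.1.adicCompletion L) w) - 1) ∧
          LabelPlus (galAdicCompletionMap (L := L) (IsCMField.complexConj L) hw) ϖ d (d % 2 + 2 * d - 1)
            (((n : ↥(unitaryGroupOfForm (conjLocal L (IsCMField.complexConj L) v) (cmLocalForm L 3 v))) : GL (Fin 3) (LocalRing L v)).val.map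
                (Pi.evalRingHom (fun w' : PlacesOver L v => w'.1.adicCompletion L) w) - 1)} (fun _ => (1 : ℂ)) := by
    funext n
    rw [hg1, ← hpre]
    exact (Set.indicator_comp_right (fun n : ↥(unipotentU (conjLocal L (IsCMField.complexConj L) v) (cmLocalForm L 3 v)) => ((n : ↥(unitaryGroupOfForm (conjLocal L (IsCMField.complexConj L) v) (cmLocalForm L 3 v))) : ((cmDatum L 3 (Matrix.of fun i j : Fin 3 => if i.val + j.val + 1 = 3 then (1 : L) else 0)).Local v)))).symm
  rw [e, integral_indicator_const _ hS, Complex.real_smul, mul_one]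

/-! ## §2  THE EXACT LAW: row (3)'s `G`-side of the labelled piece -/

/-- **ROW (3) `G`-SIDE OF `f_{T+}`, EXACT** (`d ≥ 2`).  At a wild ramified non-split CM place with datum `(ϖ, d, t_E)`, for the transfer factor of record `Δ‴_v[μ]`, canonical families
`mH`, `mG₃` (any Haar `νH`, `νG₃`) and any s-finite Haar `μ_N` on `N(L⁺_v)` (a witness — it cancels): there is `V ∈ 𝓝 (1 : H_v)` such that for every `G`-regular `γ_H ∈ V`
which is `H_v`-conjugate to a diagonal,
`Σᶠ_c Δ‴(γ_H, out c)·Φ(c, gselStar 1) = ((1 − q_v⁻¹)∕2 · q_v^{−((d%2 + 3d − 1)∕2 − d∕2)}) · (νG₃(K)∕νH(K_H)) · Φ^st(γ_H, hFamily 0)` (exponent = `d − 1 + ℓ₀`; `ℕ`-divisions as ★ p859349).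
★ p858969 (`j = 1`) ∘ §1 ∘ ★ p859349 ∘ cancellation of `μ_N.real{n ∈ K} ≠ 0` (★ p859150).
[cite: Rogawski1990, §4.9 Prop. 4.9.1 (b) p. 55, Lemma 4.9.2 p. 56; §4.3 (4.3.1) p. 43; §3.5 Prop. 3.5.2 pp. 25–26] [cite: Kottwitz1986BaseChangeUnits, §1 pp. 240–241] [cite: Serre1979, Ch. V §3] -/
theorem exists_nhds_one_finsum_delta_pieceTransvPlus_eq_of_levi
    (L : Type) [Field L] [NumberField L] [IsCMField L]
    {v : HeightOneSpectrum (𝓞 ↥(maximalRealSubfield L))} (w : UnitaryGroup.PlacesOver L v)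
    (hw : IsCMField.complexConj L • w.1 = w.1)
    (he : v.asIdeal.ramificationIdx' w.1.asIdeal ≠ 1)
    (h2 : ¬ IsUnit (2 : 𝒪[w.1.adicCompletion L]))
    (ϖ : w.1.adicCompletion L) (hϖ : Valued.v ϖ = WithZero.exp (-1 : ℤ))
    (d tE : ℕ) (hD : IsRamifiedQuadraticDatum (galAdicCompletionMap (L := L) (IsCMField.complexConj L) hw) ϖ d tE) (h2d : 2 ≤ d)
    (μ : HeckeCharacter L)
    (hμω : ∀ x : ideleGroup ↥(maximalRealSubfield L), μ (AdeleRing.ideleBaseChange ↥(maximalRealSubfield L) L x) = quadraticHeckeCharCM L x)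
    [MeasurableSpace ((cmDatum L 3 (Matrix.of fun i j : Fin 3 => if i.val + j.val + 1 = 3 then (1 : L) else 0)).Local v)]
    [BorelSpace ((cmDatum L 3 (Matrix.of fun i j : Fin 3 => if i.val + j.val + 1 = 3 then (1 : L) else 0)).Local v)]
    [∀ γ : ((cmDatum L 3 (Matrix.of fun i j : Fin 3 => if i.val + j.val + 1 = 3 then (1 : L) else 0)).Local v),
      MeasurableSpace (((cmDatum L 3 (Matrix.of fun i j : Fin 3 => if i.val + j.val + 1 = 3 then (1 : L) else 0)).Local v) ⧸
        Subgroup.centralizer ({γ} : Set ((cmDatum L 3 (Matrix.of fun i j : Fin 3 => if i.val + j.val + 1 = 3 then (1 : L) else 0)).Local v)))]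
    [∀ γ : ((cmDatum L 3 (Matrix.of fun i j : Fin 3 => if i.val + j.val + 1 = 3 then (1 : L) else 0)).Local v),
      BorelSpace (((cmDatum L 3 (Matrix.of fun i j : Fin 3 => if i.val + j.val + 1 = 3 then (1 : L) else 0)).Local v) ⧸
        Subgroup.centralizer ({γ} : Set ((cmDatum L 3 (Matrix.of fun i j : Fin 3 => if i.val + j.val + 1 = 3 then (1 : L) else 0)).Local v)))]
    [MeasurableSpace ((cmDatum L 2 (Matrix.of fun i j : Fin 2 => if i.val + j.val + 1 = 2 then (1 : L) else 0)).Local v ×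
      (cmDatum L 1 (Matrix.of fun i j : Fin 1 => if i.val + j.val + 1 = 1 then (1 : L) else 0)).Local v)]
    [BorelSpace ((cmDatum L 2 (Matrix.of fun i j : Fin 2 => if i.val + j.val + 1 = 2 then (1 : L) else 0)).Local v ×
      (cmDatum L 1 (Matrix.of fun i j : Fin 1 => if i.val + j.val + 1 = 1 then (1 : L) else 0)).Local v)]
    [∀ a : ((cmDatum L 2 (Matrix.of fun i j : Fin 2 => if i.val + j.val + 1 = 2 then (1 : L) else 0)).Local v ×
      (cmDatum L 1 (Matrix.of fun i j : Fin 1 => if i.val + j.val + 1 = 1 then (1 : L) else 0)).Local v),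
      MeasurableSpace (((cmDatum L 2 (Matrix.of fun i j : Fin 2 => if i.val + j.val + 1 = 2 then (1 : L) else 0)).Local v ×
      (cmDatum L 1 (Matrix.of fun i j : Fin 1 => if i.val + j.val + 1 = 1 then (1 : L) else 0)).Local v) ⧸ Subgroup.centralizer ({a} : Set ((cmDatum L 2 (Matrix.of fun i j : Fin 2 => if i.val + j.val + 1 = 2 then (1 : L) else 0)).Local v ×
      (cmDatum L 1 (Matrix.of fun i j : Fin 1 => if i.val + j.val + 1 = 1 then (1 : L) else 0)).Local v)))]
    [∀ a : ((cmDatum L 2 (Matrix.of fun i j : Fin 2 => if i.val + j.val + 1 = 2 then (1 : L) else 0)).Local v ×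
      (cmDatum L 1 (Matrix.of fun i j : Fin 1 => if i.val + j.val + 1 = 1 then (1 : L) else 0)).Local v),
      BorelSpace (((cmDatum L 2 (Matrix.of fun i j : Fin 2 => if i.val + j.val + 1 = 2 then (1 : L) else 0)).Local v ×
      (cmDatum L 1 (Matrix.of fun i j : Fin 1 => if i.val + j.val + 1 = 1 then (1 : L) else 0)).Local v) ⧸ Subgroup.centralizer ({a} : Set ((cmDatum L 2 (Matrix.of fun i j : Fin 2 => if i.val + j.val + 1 = 2 then (1 : L) else 0)).Local v ×
      (cmDatum L 1 (Matrix.of fun i j : Fin 1 => if i.val + j.val + 1 = 1 then (1 : L) else 0)).Local v)))]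
    (νH : Measure ((cmDatum L 2 (Matrix.of fun i j : Fin 2 => if i.val + j.val + 1 = 2 then (1 : L) else 0)).Local v ×
      (cmDatum L 1 (Matrix.of fun i j : Fin 1 => if i.val + j.val + 1 = 1 then (1 : L) else 0)).Local v)) [νH.IsHaarMeasure] [νH.IsMulRightInvariant]
    (νG₃ : Measure ((cmDatum L 3 (Matrix.of fun i j : Fin 3 => if i.val + j.val + 1 = 3 then (1 : L) else 0)).Local v)) [νG₃.IsHaarMeasure] [νG₃.IsMulRightInvariant]
    {mH : OrbitalMeasureFamily ((cmDatum L 2 (Matrix.of fun i j : Fin 2 => if i.val + j.val + 1 = 2 then (1 : L) else 0)).Local v ×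
      (cmDatum L 1 (Matrix.of fun i j : Fin 1 => if i.val + j.val + 1 = 1 then (1 : L) else 0)).Local v)}
    {mG₃ : OrbitalMeasureFamily ((cmDatum L 3 (Matrix.of fun i j : Fin 3 => if i.val + j.val + 1 = 3 then (1 : L) else 0)).Local v)}
    (hmH : mH.IsCanonical (IsLocalGRegular L v) νH)
    (hmG : mG₃.IsCanonical (fun γ => IsRegularElt (γ.val : GL (Fin 3) (UnitaryGroup.LocalRing L v))) νG₃)
    [MeasurableSpace ↥(unitaryGroupOfForm (conjLocal L (IsCMField.complexConj L) v) (cmLocalForm L 3 v))] [BorelSpace ↥(unitaryGroupOfForm (conjLocal L (IsCMField.complexConj L) v) (cmLocalForm L 3 v))]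
    (μN : Measure ↥(unipotentU (conjLocal L (IsCMField.complexConj L) v) (cmLocalForm L 3 v))) [μN.IsHaarMeasure] [SFinite μN] :
    ∃ V ∈ 𝓝 (1 : ((cmDatum L 2 (Matrix.of fun i j : Fin 2 => if i.val + j.val + 1 = 2 then (1 : L) else 0)).Local v ×
        (cmDatum L 1 (Matrix.of fun i j : Fin 1 => if i.val + j.val + 1 = 1 then (1 : L) else 0)).Local v)),
      ∀ γH ∈ V, IsLocalGRegular L v γH →
        (∃ (y : ((cmDatum L 2 (Matrix.of fun i j : Fin 2 => if i.val + j.val + 1 = 2 then (1 : L) else 0)).Local v ×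
            (cmDatum L 1 (Matrix.of fun i j : Fin 1 => if i.val + j.val + 1 = 1 then (1 : L) else 0)).Local v)) (d' : Fin 2 → (UnitaryGroup.LocalRing L v)ˣ),
            glDiagonal 2 (UnitaryGroup.LocalRing L v) d' = ((y * γH * y⁻¹).1.val : GL (Fin 2) (UnitaryGroup.LocalRing L v))) →
        ∑ᶠ c : ConjClasses ((cmDatum L 3 (Matrix.of fun i j : Fin 3 => if i.val + j.val + 1 = 3 then (1 : L) else 0)).Local v),
            ((finExplicitCollection L (Matrix.of fun i j : Fin 3 => if i.val + j.val + 1 = 3 then (1 : L) else 0) μ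
              (finExplicitDelta_conj_left_all L (Matrix.of fun i j : Fin 3 => if i.val + j.val + 1 = 3 then (1 : L) else 0) μ)
              (finExplicitDelta_conj_right_all L (Matrix.of fun i j : Fin 3 => if i.val + j.val + 1 = 3 then (1 : L) else 0) μ)) v).Δ γH (Quotient.out c) *
            classOrbitalIntegral mG₃ ((gselStar 1) L v w hw ϖ) c =
          ((((1 - ((Ideal.absNorm v.asIdeal : ℝ))⁻¹) / 2) * (((Ideal.absNorm v.asIdeal : ℝ) ^ ((d % 2 + 3 * d - 1) / 2 - d / 2))⁻¹)) : ℂ) *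
          (((νG₃.real (cmLocalIntegralLevel L 3 (Matrix.of fun i j : Fin 3 => if i.val + j.val + 1 = 3 then (1 : L) else 0) v : Set ((cmDatum L 3 (Matrix.of fun i j : Fin 3 => if i.val + j.val + 1 = 3 then (1 : L) else 0)).Local v)) : ℂ) /
            (νH.real ((((cmLocalIntegralLevel L 2 (Matrix.of fun i j : Fin 2 => if i.val + j.val + 1 = 2 then (1 : L) else 0) v).prod
              (cmLocalIntegralLevel L 1 (Matrix.of fun i j : Fin 1 => if i.val + j.val + 1 = 1 then (1 : L) else 0) v) : Subgroup _) : Set _)) : ℂ)) *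
          stableOrbitalIntegralRel (IsLocalStablyConjH L v) mH (hFamily L w hw ϖ 0) γH) := by
  obtain ⟨V, hV, hrow⟩ := exists_nhds_one_finsum_delta_gselStar_mul_measureReal_eq_of_levi L w hw he h2 ϖ hϖ μ hμω νH νG₃ hmH hmG μN 1
  refine ⟨V, hV, fun γH hγ hreg hlevi => ?_⟩
  have e := hrow γH hγ hreg hlevi
  -- the labelled fibre volume (★ p859349), in `measureReal` form
  have hT := measure_setOf_mem_and_nearTransvShell_and_labelPlus_eq L v w hw μN he hD h2d
  have hTr : μN.real {n : ↥(unipotentU (conjLocal L (IsCMField.complexConj L) v) (cmLocalForm L 3 v)) | (n : ↥(unitaryGroupOfForm (conjLocal L (IsCMField.complexConj L) v) (cmLocalForm L 3 v))) ∈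
            cmLocalIntegralLevel L 3 (Matrix.of fun i j : Fin 3 => if i.val + j.val + 1 = 3 then (1 : L) else 0) v ∧
          NearTransvShell ϖ (d % 2) (d % 2 + 2 * d - 1)
            (((n : ↥(unitaryGroupOfForm (conjLocal L (IsCMField.complexConj L) v) (cmLocalForm L 3 v))) : GL (Fin 3) (LocalRing L v)).val.map
                (Pi.evalRingHom (fun w' : PlacesOver L v => w'.1.adicCompletion L) w) - 1) ∧
          LabelPlus (galAdicCompletionMap (L := L) (IsCMField.complexConj L) hw) ϖ d (d % 2 + 2 * d - 1)
            (((n : ↥(unitaryGroupOfForm (conjLocal L (IsCMField.complexConj L) v) (cmLocalForm L 3 v))) : GL (Fin 3) (LocalRing L v)).val.map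
                (Pi.evalRingHom (fun w' : PlacesOver L v => w'.1.adicCompletion L) w) - 1)} = (((1 - ((Ideal.absNorm v.asIdeal : ℝ))⁻¹) / 2) * (((Ideal.absNorm v.asIdeal : ℝ) ^ ((d % 2 + 3 * d - 1) / 2 - d / 2))⁻¹)) * μN.real {n : ↥(unipotentU (conjLocal L (IsCMField.complexConj L) v) (cmLocalForm L 3 v)) | ((n : ↥(unitaryGroupOfForm (conjLocal L (IsCMField.complexConj L) v) (cmLocalForm L 3 v))) : ((cmDatum L 3 (Matrix.of fun i j : Fin 3 => if i.val + j.val + 1 = 3 then (1 : L) else 0)).Local v)) ∈ cmLocalIntegralLevel L 3 (Matrix.of fun i j : Fin 3 => if i.val + j.val + 1 = 3 then (1 : L) else 0) v} := by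
    have hq1 : ((Ideal.absNorm v.asIdeal : ℝ≥0))⁻¹ ≤ 1 := by
      apply inv_le_one_of_one_le₀
      have h1 : 1 ≤ Ideal.absNorm v.asIdeal :=
        Nat.one_le_iff_ne_zero.mpr (by rw [Ne, Ideal.absNorm_eq_zero_iff]; exact v.ne_bot)
      exact_mod_cast h1
    rw [measureReal_def, measureReal_def, hT, ENNReal.toReal_smul, NNReal.smul_def, smul_eq_mul, NNReal.coe_mul, NNReal.coe_div,
      NNReal.coe_sub hq1]
    simp only [NNReal.coe_inv, NNReal.coe_pow, NNReal.coe_natCast, NNReal.coe_one, NNReal.coe_ofNat]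
  rw [integral_gselStar_one_eq L w hw he ϖ hϖ hD μN, hTr] at e
  have hK0 : ((μN.real {n : ↥(unipotentU (conjLocal L (IsCMField.complexConj L) v) (cmLocalForm L 3 v)) | ((n : ↥(unitaryGroupOfForm (conjLocal L (IsCMField.complexConj L) v) (cmLocalForm L 3 v))) : ((cmDatum L 3 (Matrix.of fun i j : Fin 3 => if i.val + j.val + 1 = 3 then (1 : L) else 0)).Local v)) ∈ cmLocalIntegralLevel L 3 (Matrix.of fun i j : Fin 3 => if i.val + j.val + 1 = 3 then (1 : L) else 0) v} : ℝ) : ℂ) ≠ 0 := by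
    rw [Ne, Complex.ofReal_eq_zero]; exact measureReal_setOf_mem_cmLocalIntegralLevel_ne_zero L μN
  apply mul_right_cancel₀ hK0
  rw [e]
  push_cast
  ring

end Summit.HodgeConjecture.HodgeConjecture.Cruxes.H413.F0P3cDyRamTransvPlusLeviRow

end
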